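import Literature.Topology.FourManifolds.EmbeddedSurfaceNormalPlane
import Mathlib.Geometry.Manifold.MFDeriv.FDeriv
import Mathlib.Geometry.Manifold.ContMDiff.NormedSpace
import Mathlib.Analysis.Calculus.FDeriv.CompCLM

/-!
# The linearisation of the tautological normal section along a curve through the surface
(registered helper `helper_wVecDerivAlongCurve` of the stub `stub_normalWitnessTransfer`, line
`cross-cap-laurent`, crux `GromovRecognitionRelEnd`, item stmt-SmoothPoincare4-11009)

Setting (`Literature.Topology.FourManifolds.CodimTwoData`, the Whitney picture of R. C. Kirby,
*The Topology of 4-Manifolds*, LNM 1374 (1989), Ch. VIII, proof of Thm. 2, pp. 44–45, read in an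
embedding `e : X → V` as in M. W. Hirsch, *Differential Topology* (1976), Ch. 4 §5): a compact
`k`-manifold `b : S → X` in a `(k + 2)`-manifold `X ⊆ V`, `f = e ∘ b`, the normal planes `F y` with
orthogonal projections `Q y`, the nearest-point map `x(z) = nearPt ε z` of a tube radius `ε` and
the tautological normal section `w(z) = Q_{x(z)} (z - f (x(z)))`.

Claim (`helper_wVecDerivAlongCurve`): for a smooth map `γ : ℂ → X` with `γ ζ₀ = b x₀`, the
composite `ζ ↦ w (e (γ ζ))` (a map `ℂ → V` of real vector spaces) is Fréchet differentiable at
`ζ₀` with derivative `Q_{x₀} ∘ d(e ∘ γ)_{ζ₀}`: the linearisation of the tautological section at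
a point of the core is the normal projection of the velocity.

Proof (product rule at a zero; folklore, cf. Kirby loc. cit. "the section `s(e) = (e, e)` of
`π*ν` … is transverse to the zero section"): with `c = e ∘ γ`, write
`w (c ζ) = B ζ (A ζ)` where `B ζ = Q_{x(c ζ)}` is differentiable at `ζ₀` (smoothness of `Q` and
of the nearest-point retraction on the open metric tube, which contains `c ζ₀ = f x₀`) and
`A ζ = c ζ - f (x (c ζ))` is differentiable at `ζ₀` with `A ζ₀ = 0` (as `x (f x₀) = x₀`). Hence
the derivative is `B ζ₀ ∘ A'(ζ₀) = Q_{x₀} ∘ (dc - df_{x₀} ∘ dx ∘ dc) = Q_{x₀} ∘ dc`, because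
`Q_{x₀}` kills the values of `df_{x₀}` (they are tangent to the surface). Manifold derivatives
between vector spaces are Fréchet derivatives (`hasMFDerivAt_iff_hasFDerivAt`).
No new definitions.
-/

noncomputable section

open scoped Manifold ContDiff Topology
open Set Function Metric

-- the prescribed namespace `Summit.<P>.<Sub>.…` duplicates `SmoothPoincare4` (P = Sub)
set_option linter.dupNamespace false

namespace Summit.SmoothPoincare4.SmoothPoincare4.Theorems.GromovRecognitionRelEnd.CrossCapLaurent

namespace HelperWVecDerivAlongCurve

open Literature.Topology.FourManifolds

variable {k : ℕ} {X : Type*} [TopologicalSpace X] [ChartedSpace (EuclideanSpace ℝ (Fin (k + 2))) X]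
  [IsManifold (𝓡 (k + 2)) ∞ X]
  {S : Type*} [TopologicalSpace S] [ChartedSpace (EuclideanSpace ℝ (Fin k)) S]
  [IsManifold (𝓡 k) ∞ S] [CompactSpace S] [Nonempty S]
  {V : Type*} [NormedAddCommGroup V] [InnerProductSpace ℝ V] [FiniteDimensional ℝ V]
  (D : CodimTwoData k X S V)

/-- **Product rule at a zero of the tautological section.** For a map `c : ℂ → V` smooth at `ζ₀`
with `c ζ₀ = f x₀` on the surface and a tube radius `ε`, the composite `ζ ↦ w (c ζ)` of the
tautological normal section `w = wVec ε` with `c` is Fréchet differentiable at `ζ₀` with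
derivative `Q_{x₀} ∘ dc_{ζ₀}`. [folklore] -/
theorem hasFDerivAt_wVec_comp {ε : ℝ} (hε : D.IsTubeRadius ε) {c : ℂ → V} {ζ₀ : ℂ} {x₀ : S}
    (hc : ContMDiffAt 𝓘(ℝ, ℂ) 𝓘(ℝ, V) ∞ c ζ₀) (h0 : c ζ₀ = D.f x₀) :
    HasFDerivAt (fun ζ => D.wVec ε (c ζ))
      ((D.Q x₀).comp (mfderiv 𝓘(ℝ, ℂ) 𝓘(ℝ, V) c ζ₀)) ζ₀ := by
  -- the open metric tube is a neighbourhood of `c ζ₀ = f x₀`, so `nearPt ε` is smooth there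
  have hmem : {z : V | infDist z D.img < ε} ∈ 𝓝 (c ζ₀) := by
    refine (D.isOpen_setOf_infDist_lt ε).mem_nhds ?_
    rw [mem_setOf_eq, h0, D.infDist_f_img]
    exact hε.pos
  have hn : ContMDiffAt 𝓘(ℝ, V) (𝓡 k) ∞ (D.nearPt ε) (c ζ₀) :=
    (D.contMDiffOn_nearPt hε).contMDiffAt hmem
  have hx : D.nearPt ε (c ζ₀) = x₀ := by rw [h0, D.nearPt_f hε]
  have hz : c ζ₀ - D.f (D.nearPt ε (c ζ₀)) = 0 := by rw [hx, h0, sub_self]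
  -- the derivatives of `c`, of `nearPt ε` and of `f`, as manifold derivatives
  have hcm : HasMFDerivAt 𝓘(ℝ, ℂ) 𝓘(ℝ, V) c ζ₀ (mfderiv 𝓘(ℝ, ℂ) 𝓘(ℝ, V) c ζ₀) :=
    (hc.mdifferentiableAt (by simp)).hasMFDerivAt
  have hnd : HasMFDerivAt 𝓘(ℝ, V) (𝓡 k) (D.nearPt ε) (c ζ₀)
      (mfderiv 𝓘(ℝ, V) (𝓡 k) (D.nearPt ε) (c ζ₀)) :=
    (hn.mdifferentiableAt (by simp)).hasMFDerivAt
  have hfd : HasMFDerivAt (𝓡 k) 𝓘(ℝ, V) D.f (D.nearPt ε (c ζ₀))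
      (mfderiv (𝓡 k) 𝓘(ℝ, V) D.f (D.nearPt ε (c ζ₀))) :=
    (D.mdifferentiableAt_f _).hasMFDerivAt
  -- read them as Fréchet derivatives of maps of the fixed vector spaces `ℂ`, `V`
  obtain ⟨c', hc', hc'eq⟩ : ∃ c' : ℂ →L[ℝ] V, HasFDerivAt c c' ζ₀ ∧
      c' = mfderiv 𝓘(ℝ, ℂ) 𝓘(ℝ, V) c ζ₀ :=
    ⟨_, hasMFDerivAt_iff_hasFDerivAt.1 hcm, rfl⟩
  -- `ζ ↦ f (nearPt (c ζ))` (chain rule on manifolds); `Q` at the nearest point kills `df`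
  obtain ⟨L, hL, hQL⟩ : ∃ L : ℂ →L[ℝ] V, HasFDerivAt (fun ζ => D.f (D.nearPt ε (c ζ))) L ζ₀ ∧
      ∀ v, D.Q (D.nearPt ε (c ζ₀)) (L v) = 0 := by
    refine ⟨_, hasMFDerivAt_iff_hasFDerivAt.1 ((hfd.comp (c ζ₀) hnd).comp ζ₀ hcm), fun v => ?_⟩
    simp only [Function.comp_apply]
    exact D.Q_mfderiv_f _ _
  -- `A ζ = c ζ - f (nearPt (c ζ))` is differentiable at `ζ₀`, where it vanishes
  have hA : HasFDerivAt (fun ζ => c ζ - D.f (D.nearPt ε (c ζ))) (c' - L) ζ₀ := hc'.sub hL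
  -- `B ζ = Q (nearPt (c ζ))` is differentiable at `ζ₀`
  have hB : DifferentiableAt ℝ (fun ζ => D.Q (D.nearPt ε (c ζ))) ζ₀ := by
    have h1 : ContMDiffAt 𝓘(ℝ, ℂ) 𝓘(ℝ, V →L[ℝ] V) ∞ (fun ζ => D.Q (D.nearPt ε (c ζ))) ζ₀ :=
      (D.contMDiff_Q.contMDiffAt.comp (c ζ₀) hn).comp ζ₀ hc
    exact (h1.mdifferentiableAt (by simp)).differentiableAt
  -- product rule for `w (c ζ) = B ζ (A ζ)`
  have hw : HasFDerivAt (fun ζ => D.wVec ε (c ζ))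
      ((D.Q (D.nearPt ε (c ζ₀))).comp (c' - L) +
        (fderiv ℝ (fun ζ => D.Q (D.nearPt ε (c ζ))) ζ₀).flip
          (c ζ₀ - D.f (D.nearPt ε (c ζ₀)))) ζ₀ :=
    hB.hasFDerivAt.clm_apply hA
  refine hw.congr_fderiv ?_
  -- the derivative: the second term vanishes at the zero, and `Q` kills `df`
  have hkill : (D.Q (D.nearPt ε (c ζ₀))).comp L = 0 :=
    ContinuousLinearMap.ext fun v => by
      rw [ContinuousLinearMap.comp_apply, hQL, zero_apply]
  rw [hz, map_zero, add_zero, ContinuousLinearMap.comp_sub, hkill, sub_zero, hx, hc'eq]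
  rfl

end HelperWVecDerivAlongCurve

open Literature.Topology.FourManifolds in
/-- **The linearisation of the tautological normal section along a smooth curve of the ambient
manifold through the surface is the normal projection of the velocity**: for `γ : ℂ → X` smooth
with `γ ζ₀ = b x₀` and a tube radius `ε`, the map `ζ ↦ w (e (γ ζ))` has Fréchet derivative
`Q_{x₀} ∘ d(e ∘ γ)_{ζ₀}` at `ζ₀`. [folklore] -/
theorem helper_wVecDerivAlongCurve : ∀ (k m : ℕ) (X : Type) [TopologicalSpace X] [ChartedSpace (EuclideanSpace ℝ (Fin (k + 2))) X] [IsManifold (𝓡 (k + 2)) ∞ X] (S : Type) [TopologicalSpace S] [ChartedSpace (EuclideanSpace ℝ (Fin k)) S] [IsManifold (𝓡 k) ∞ S] [CompactSpace S] [Nonempty S] (D : Literature.Topology.FourManifolds.CodimTwoData k X S (EuclideanSpace ℝ (Fin m))) (ε : ℝ) (γ : ℂ → X) (ζ₀ : ℂ) (x₀ : S), D.IsTubeRadius ε → ContMDiff 𝓘(ℝ, ℂ) (𝓡 (k + 2)) ∞ γ → γ ζ₀ = D.b x₀ → HasFDerivAt (fun ζ => D.wVec ε (D.e (γ ζ)))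 ((D.Q x₀).comp (mfderiv 𝓘(ℝ, ℂ) 𝓘(ℝ, EuclideanSpace ℝ (Fin m)) (fun ζ => D.e (γ ζ)) ζ₀)) ζ₀ := by
  intro k m X _ _ _ S _ _ _ _ _ D ε γ ζ₀ x₀ hε hγ hζ
  have hc : ContMDiffAt 𝓘(ℝ, ℂ) 𝓘(ℝ, EuclideanSpace ℝ (Fin m)) ∞ (fun ζ => D.e (γ ζ)) ζ₀ :=
    (D.he.comp hγ).contMDiffAt
  have h0 : (fun ζ => D.e (γ ζ)) ζ₀ = D.f x₀ := by
    show D.e (γ ζ₀) = D.e (D.b x₀)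
    rw [hζ]
  exact HelperWVecDerivAlongCurve.hasFDerivAt_wVec_comp D hε hc h0

end Summit.SmoothPoincare4.SmoothPoincare4.Theorems.GromovRecognitionRelEnd.CrossCapLaurent
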